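import Mathlib

/-!
# AP packing for SDPP families (crux `PrimeDensityDecay`, stmt-MatrixMultiplication-14311,
line `collision-profile-removal`, towards `stub_concentratedCoreDecay`: the 1-dimensional extreme)

Let `(A k, B k)_{k<n}` satisfy clause (X) of the SDPP in a finite additive group.  Suppose a difference
`g₀` is COMMON to all blocks (`g₀ ∈ A k − B k` for every `k`, i.e. `g₀` has the maximal sharing multiplicity
`n`), and every private difference set `A k − B k` contains the progression `g₀ + d, g₀ + 2d, …, g₀ + M d`,
where `d, 2d, …, M d ≠ 0`.  Then `n · (M + 1) ≤ |G|` (`stub_apPacking`, a registered stub of the line's skeleton).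

Proof: choose pivots `a k ∈ A k`, `b k ∈ B k` with `a k − b k = g₀`.  The translates `a k + {0, d, …, M d}`
are pairwise disjoint: if `a k + i d = a k' + j d` with `i < j`, then
`a k − b k' = g₀ + (j − i) d ∈ A k' − B k'`, i.e. `(a k − a'') + (b'' − b k') = 0` for some `a'' ∈ A k'`,
`b'' ∈ B k'`, and clause (X) forces `k = k'`, whence `(j − i) d = 0`, excluded; and `i = j` puts `a k` in
`A k ∩ A k'`, so `k = k'` by (X) again.

Consequences.  (1) The exact common INTERVAL grid in `ZMod p` (`A k − B k ⊇ c + d·{0, …, s² − 1}` for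
all `k`; e.g. every translate design `(t + [0,s), t + s·[0,s))`, whose grid is an interval of length `s²`)
has `n s² ≤ p` — translates are OPTIMAL among interval-grid designs (density `≤ 1/s`), with no appeal to
removal or Fourier analysis (`card_mul_sq_le_of_interval_grid`).  (2) Any sub-family of blocks sharing a
difference `g₀` and an AP of length `M + 1 ≥ s/ε` through it inside their grids has `n' (M+1) ≤ p`, hence
`n' s ≤ ε p`: a DENSE configuration must realise its heavy sharing (forced by removal) on grids WITHOUT
long progressions — the high-rank / digit-cube regime, where the pivot condition becomes an antichain
condition.
-/

namespace Summit.MatrixMultiplication.MatrixMultiplication.Theorems.PrimeDensityDecay.APPacking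

open scoped BigOperators Pointwise

variable {G : Type*} [AddCommGroup G] {n : ℕ}

/-- Clause (X) makes distinct blocks' `A`-parts disjoint (given a non-empty `B` partner): a common point
`x ∈ A k ∩ A k'` and any `y ∈ B k'` give the relation `(x − x) + (y − y) = 0`. -/
theorem eq_of_mem_A_of_mem_A (A B : Fin n → Finset G)
    (hX : ∀ i j k : Fin n, ∀ a ∈ A i, ∀ a' ∈ A j, ∀ b ∈ B j, ∀ b' ∈ B k,
      (a - a') + (b - b') = 0 → i = k)
    {k k' : Fin n} {x : G} (hx : x ∈ A k) (hx' : x ∈ A k') (hB : (B k').Nonempty) : k = k' := by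
  obtain ⟨y, hy⟩ := hB
  exact hX k k' k' x hx x hx' y hy y hy (by abel)

/-- The pivot step: if `a − b'` (with `a ∈ A k`, `b' ∈ B k'`) equals a private difference `a'' − b''` of
block `k'`, then clause (X) forces `k = k'`. -/
theorem eq_of_sub_eq_sub (A B : Fin n → Finset G)
    (hX : ∀ i j k : Fin n, ∀ a ∈ A i, ∀ a' ∈ A j, ∀ b ∈ B j, ∀ b' ∈ B k,
      (a - a') + (b - b') = 0 → i = k)
    {k k' : Fin n} {a b' a'' b'' : G} (ha : a ∈ A k) (hb' : b' ∈ B k') (ha'' : a'' ∈ A k')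
    (hb'' : b'' ∈ B k') (h : a - b' = a'' - b'') : k = k' :=
  hX k k' k' a ha a'' ha'' b'' hb'' b' hb'
    (by rw [show (a - a'') + (b'' - b') = (a - b') - (a'' - b'') by abel, h, sub_self])

/-- **AP packing** (registered stub `stub_apPacking` of the line's skeleton: the 1-dimensional extreme
of the core).  If `g₀` is a private difference of every block and every `A k − B k` contains
`g₀ + d, …, g₀ + M d` with `m • d ≠ 0` for `1 ≤ m ≤ M`, then clause (X) alone forces `n (M + 1) ≤ |G|`:
the pivot translates `a k + {0, d, …, M d}` are pairwise disjoint. -/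
theorem stub_apPacking :
    ∀ {H : Type*} [AddCommGroup H] [Fintype H] {n : ℕ} (A B : Fin n → Finset H),
    (∀ i j k : Fin n, ∀ a ∈ A i, ∀ a' ∈ A j, ∀ b ∈ B j, ∀ b' ∈ B k, (a - a') + (b - b') = 0 → i = k) →
    ∀ (g₀ d : H) (M : ℕ), (∀ m : ℕ, 1 ≤ m → m ≤ M → m • d ≠ 0) →
    (∀ k : Fin n, ∃ a ∈ A k, ∃ b ∈ B k, a - b = g₀) →
    (∀ k : Fin n, ∀ m : ℕ, 1 ≤ m → m ≤ M → ∃ a ∈ A k, ∃ b ∈ B k, a - b = g₀ + m • d) →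
    n * (M + 1) ≤ Fintype.card H := by
  intro H _ _ n A B hX g₀ d M hd hpiv hAP
  choose a ha b hb hab using hpiv
  -- two pivot translates meeting at different heights is impossible
  have step : ∀ (k k' : Fin n) (i j : ℕ), i < j → j ≤ M → a k + i • d = a k' + j • d → False := by
    intro k k' i j hij hjM he
    have hm1 : 1 ≤ j - i := Nat.one_le_iff_ne_zero.mpr (Nat.sub_ne_zero_of_lt hij)
    have hmM : j - i ≤ M := le_trans (Nat.sub_le j i) hjM
    have hj : j • d = (j - i) • d + i • d := by
      rw [← add_nsmul, Nat.sub_add_cancel hij.le]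
    obtain ⟨a'', ha'', b'', hb'', hab''⟩ := hAP k' (j - i) hm1 hmM
    have e1 : a k = a k' + j • d - i • d := eq_sub_of_add_eq he
    have e2 : b k' = a k' - g₀ := by rw [← hab k']; abel
    have hdiff : a k - b k' = g₀ + (j - i) • d := by
      rw [e1, e2, hj]; abel
    have hkk : k = k' := eq_of_sub_eq_sub A B hX (ha k) (hb k') ha'' hb'' (hdiff.trans hab''.symm)
    subst hkk
    have h0 : i • d = j • d := add_left_cancel he
    have h1 : i • d = (j - i) • d + i • d := h0.trans hj
    exact hd (j - i) hm1 hmM (by simpa using h1.symm)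
  -- hence (k, i) ↦ a k + i • d is injective on Fin n × Fin (M + 1)
  let f : Fin n × Fin (M + 1) → H := fun q => a q.1 + (q.2 : ℕ) • d
  have hinj : Function.Injective f := by
    rintro ⟨k, i⟩ ⟨k', j⟩ he
    have he' : a k + (i : ℕ) • d = a k' + (j : ℕ) • d := he
    rcases lt_trichotomy (i : ℕ) (j : ℕ) with hij | hij | hij
    · exact (step k k' i j hij (Nat.lt_succ_iff.mp j.isLt) he').elim
    · have hij' : i = j := Fin.ext hij
      subst hij'
      have hak : a k = a k' := add_right_cancel he'
      have hkk : k = k' :=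
        eq_of_mem_A_of_mem_A A B hX (ha k) (hak ▸ ha k') ⟨b k', hb k'⟩
      subst hkk
      rfl
    · exact (step k' k j i hij (Nat.lt_succ_iff.mp i.isLt) he'.symm).elim
  simpa [Fintype.card_prod, Fintype.card_fin] using Fintype.card_le_of_injective f hinj

/-- **Interval grids pack like translates.** In `ZMod p`, if every block's private difference set
contains the progression `c, c + d, …, c + (s² − 1) d` with `d ≠ 0` (e.g. an exact common interval grid
`A k − B k = c + d·[0, s²)`, as for every translate design), then clause (X) forces `n s² ≤ p`:
density `n s / p ≤ 1/s`. -/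
theorem card_mul_sq_le_of_interval_grid (p : ℕ) [Fact p.Prime] (s : ℕ)
    (A B : Fin n → Finset (ZMod p))
    (hX : ∀ i j k : Fin n, ∀ a ∈ A i, ∀ a' ∈ A j, ∀ b ∈ B j, ∀ b' ∈ B k,
      (a - a') + (b - b') = 0 → i = k)
    (c d : ZMod p) (hd : d ≠ 0) (hs : s ^ 2 ≤ p)
    (hgrid : ∀ k : Fin n, ∀ m : ℕ, m < s ^ 2 → ∃ a ∈ A k, ∃ b ∈ B k, a - b = c + m • d) :
    n * s ^ 2 ≤ p := by
  rcases Nat.eq_zero_or_pos (s ^ 2) with h0 | hpos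
  · rw [h0]; simp
  · have hM : s ^ 2 - 1 + 1 = s ^ 2 := Nat.sub_add_cancel hpos
    have key := stub_apPacking A B hX c d (s ^ 2 - 1)
      (by
        intro m hm1 hmM hmd
        have hmp : m < p := by omega
        have hcast : (m : ZMod p) = 0 := by
          have : (m : ZMod p) * d = 0 := by rwa [← nsmul_eq_mul]
          rcases mul_eq_zero.mp this with h | h
          · exact h
          · exact absurd h hd
        rw [ZMod.natCast_eq_zero_iff] at hcast
        exact absurd (Nat.le_of_dvd (by omega) hcast) (by omega))
      (fun k => by simpa using hgrid k 0 hpos)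
      (fun k m _ hmM => hgrid k m (by omega))
    rw [hM, ZMod.card] at key
    exact key

end Summit.MatrixMultiplication.MatrixMultiplication.Theorems.PrimeDensityDecay.APPacking
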